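import Summits.CriticalPhenomena.CardyFormulaZ2.Theorems.CardyMeckeFlipMeckeRigidityToggledIntegrand
import Summits.CriticalPhenomena.CardyFormulaZ2.Theorems.CardyMeckeFlipMeckeRigidityFlipExtremalConst
import Summits.CriticalPhenomena.CardyFormulaZ2.Theorems.CardyMeckeFlipMeckeRigidityCylinderLocality
import Mathlib.MeasureTheory.Function.ConvergenceInMeasure
import Mathlib.MeasureTheory.Integral.DominatedConvergence
import Mathlib.Analysis.SpecificLimits.Basic

/-!
# Flip-extremality makes far-cylinder-approximable densities constant (tail triviality)

Route `Summits/CriticalPhenomena/CardyFormulaZ2/Theses/CardyMeckeFlip`, crux `MeckeRigidity`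
(item stmt-CriticalPhenomena-14826), line `registered`, stub `stub_crossingUniqueness` (helper: the
"extremal ⟹ ergodic" step of the stationary-uniqueness programme, in the form every spatial
ergodic theorem consumes).

Let `P` be a probability law on `ℋ_D` with an admissible kernel family `M` ((ADM)), flip-fair at
every cutoff ((F)) and flip-extremal ((EXT)).  If a measurable `h : ℋ_D → [0,1]` is, for every
radius `r`, an `L¹(P)`-limit of `[0,1]`-valued CYLINDER functions of quads whose carriers avoid
`B̄(0,r)` ("far-cylinder approximable" — e.g. any tail-measurable density, any Birkhoff limit along
a translation), then `h` is a.s. constant (`ae_eq_const_of_farCylinderApprox`; registered `∀`-form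
`flipExtremal_ae_eq_const_of_farCylinderApprox`).  Assembly of the landed pieces: cylinder locality
of (F) (`flipFair_integral_cylinder_mul_eq`: the approximants' tilts balance against test functions
supported in `B̄(0,r)`), `L¹` bookkeeping of both Campbell integrands (`integrable_patternIntegrand`,
`integrable_toggledIntegrand`), dominated convergence along an a.e.-convergent subsequence, and
the extremal ⟹ constant lemma (`ae_eq_const_of_isFlipExtremal`).
-/

noncomputable section

open MeasureTheory Set Metric Filter Topology
open scoped ENNReal NNReal
open Literature.Probability.Percolation Literature.Probability.Percolation.QuadCrossing

namespace Summit.CriticalPhenomena.CardyFormulaZ2.Theorems.CardyMeckeFlip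

variable {D : Set ℂ}

/-! ### Far-cylinder approximable densities are a.s. constant -/

/-- `tsupport φ` lies in every closed ball off which `φ` vanishes. [folklore] -/
theorem tsupport_subset_closedBall_of_eq_zero_off {φ : ℂ → ℝ} {r : ℝ}
    (hr : ∀ x, x ∉ closedBall (0 : ℂ) r → φ x = 0) : tsupport φ ⊆ closedBall (0 : ℂ) r :=
  closure_minimal (fun x hx => by
    by_contra hxr
    exact hx (hr x hxr)) isClosed_closedBall

/-- **Flip-extremality forces far-cylinder-approximable densities to be constant.**  Let `P` be
a probability law with an admissible kernel family `M` ((ADM)), flip-fair at every cutoff ((F))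
and flip-extremal ((EXT)).  If a measurable `h : ℋ_D → [0,1]` can be approximated in `L¹(P)`, to
any precision and for every radius `r`, by `[0,1]`-valued cylinder functions of quads whose
carriers avoid `B̄(0,r)`, then `h = ∫ h dP` almost surely.  (Cylinder locality of (F) makes the
approximants' tilts balance; dominated convergence along an a.e.-convergent subsequence passes
the balance to `h`; the extremal ⟹ constant lemma concludes.) [folklore] -/
theorem ae_eq_const_of_farCylinderApprox
    {P : Measure (QuadConfig D)} [IsProbabilityMeasure P] {M : ℝ → QuadConfig D → Measure ℂ}
    (hADM : IsAdmissibleKernel P M) (hF : ∀ ε : ℝ, 0 < ε → IsFlipFairKernel P (M ε))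
    (hEXT : IsFlipExtremal P M) {h : QuadConfig D → ℝ} (hhm : Measurable h)
    (hh : ∀ S, 0 ≤ h S ∧ h S ≤ 1)
    (happrox : ∀ (r : ℕ) (δ : ℝ), 0 < δ → ∃ (m : ℕ) (Qf : Fin m → Quad D) (G : Set (Fin m) → ℝ),
      (∀ A, 0 ≤ G A ∧ G A ≤ 1) ∧ (∀ j, Disjoint (Qf j).carrier (Metric.closedBall (0 : ℂ) r)) ∧
        ∫ S, |h S - G {j | Qf j ∈ S}| ∂P ≤ δ) :
    h =ᵐ[P] fun _ => ∫ S, h S ∂P := by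
  -- (a) a sequence of far cylinder approximants, `1/(k+1)`-close in `L¹`, off `B̄(0,k)`
  choose m Qf G hG hfar hL1 using fun k : ℕ => happrox k (1 / ((k : ℝ) + 1)) (by positivity)
  have hc_meas : ∀ k, Measurable fun S : QuadConfig D => G k {j | Qf k j ∈ S} := fun k =>
    measurable_comp_quadPattern (Qf k) (G k)
  have hc_bd : ∀ k (S : QuadConfig D), 0 ≤ G k {j | Qf k j ∈ S} ∧ G k {j | Qf k j ∈ S} ≤ 1 :=
    fun k S => hG k _
  have hc_norm : ∀ k (S : QuadConfig D), ‖G k {j | Qf k j ∈ S}‖ ≤ 1 := fun k S => by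
    rw [Real.norm_eq_abs, abs_le]
    exact ⟨by linarith [(hc_bd k S).1], (hc_bd k S).2⟩
  obtain ⟨hhi, -, -⟩ := integrable_of_mem_Icc P hhm hh
  have hci : ∀ k, Integrable (fun S : QuadConfig D => G k {j | Qf k j ∈ S}) P := fun k =>
    (integrable_of_mem_Icc P (hc_meas k) (hc_bd k)).1
  -- (b) `L¹` convergence ⟹ convergence in measure ⟹ a.e. convergence along a subsequence
  have htim : TendstoInMeasure P (fun k (S : QuadConfig D) => G k {j | Qf k j ∈ S}) atTop h := by
    refine tendstoInMeasure_of_tendsto_eLpNorm one_ne_zero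
      (fun k => (hc_meas k).aestronglyMeasurable) hhm.aestronglyMeasurable ?_
    have hle : ∀ k : ℕ, eLpNorm ((fun S : QuadConfig D => G k {j | Qf k j ∈ S}) - h) 1 P ≤
        ENNReal.ofReal (1 / ((k : ℝ) + 1)) := by
      intro k
      rw [eLpNorm_one_eq_lintegral_enorm, ← ofReal_integral_norm_eq_lintegral_enorm ((hci k).sub hhi)]
      refine ENNReal.ofReal_le_ofReal ?_
      have e : (fun S => ‖((fun S : QuadConfig D => G k {j | Qf k j ∈ S}) - h) S‖) =
          fun S => |h S - G k {j | Qf k j ∈ S}| := by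
        funext S
        rw [Pi.sub_apply, Real.norm_eq_abs, abs_sub_comm]
      rw [e]
      exact hL1 k
    have h0 : Tendsto (fun k : ℕ => ENNReal.ofReal (1 / ((k : ℝ) + 1))) atTop (𝓝 0) := by
      have := (ENNReal.continuous_ofReal.tendsto 0).comp
        (tendsto_one_div_add_atTop_nhds_zero_nat (𝕜 := ℝ))
      simpa only [Function.comp_def, ENNReal.ofReal_zero] using this
    exact tendsto_of_tendsto_of_tendsto_of_le_of_le tendsto_const_nhds h0 (fun _ => bot_le) hle
  obtain ⟨ns, hns, hae⟩ := htim.exists_seq_tendsto_ae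
  -- (c) the balance `∫ h·L = ∫ h·R` for every datum, then the extremal ⟹ constant lemma
  refine ae_eq_const_of_isFlipExtremal hF hEXT hhm hh fun ε hε n Q g φ hφ hφc => ?_
  have hLi := integrable_patternIntegrand hADM hε Q g hφ hφc
  have hRi := integrable_toggledIntegrand hADM hε (hF ε hε) Q g hφ hφc
  refine ⟨hLi, hRi, ?_⟩
  obtain ⟨r₀, hr₀⟩ := exists_nat_eq_zero_off_closedBall hφc
  -- for `k ≥ r₀` the approximant's quads miss `tsupport φ`, so its tilt balances (cylinder locality)
  have hbal : ∀ k : ℕ, r₀ ≤ k →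
      ∫ S, G k {j | Qf k j ∈ S} * ∫ x, φ x * g {i | Q i ∈ S} ∂(M ε S) ∂P =
        ∫ S, G k {j | Qf k j ∈ S} *
          ∫ x, φ x * g {i | Xor (Q i ∈ S) (S.IsPivotalAt x (Q i))} ∂(M ε S) ∂P := by
    intro k hk
    refine flipFair_integral_cylinder_mul_eq D P (M ε) (hF ε hε) n Q g φ hφ hφc (m k) (Qf k) (G k) fun j => ?_
    refine (hfar k j).mono_right ((tsupport_subset_closedBall_of_eq_zero_off hr₀).trans ?_)
    exact closedBall_subset_closedBall (by exact_mod_cast hk)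
  -- dominated convergence along the subsequence, on both sides
  have hlimL : Tendsto (fun i => ∫ S, G (ns i) {j | Qf (ns i) j ∈ S} *
      ∫ x, φ x * g {i | Q i ∈ S} ∂(M ε S) ∂P) atTop
        (𝓝 (∫ S, h S * ∫ x, φ x * g {i | Q i ∈ S} ∂(M ε S) ∂P)) := by
    refine tendsto_integral_of_dominated_convergence
      (fun S => ‖∫ x, φ x * g {i | Q i ∈ S} ∂(M ε S)‖)
      (fun i => ((hc_meas _).aestronglyMeasurable.mul hLi.aestronglyMeasurable)) hLi.norm
      (fun i => Eventually.of_forall fun S => ?_) ?_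
    · rw [norm_mul]
      exact mul_le_of_le_one_left (norm_nonneg _) (hc_norm _ S)
    · filter_upwards [hae] with S hS
      exact hS.mul tendsto_const_nhds
  have hlimR : Tendsto (fun i => ∫ S, G (ns i) {j | Qf (ns i) j ∈ S} *
      ∫ x, φ x * g {i | Xor (Q i ∈ S) (S.IsPivotalAt x (Q i))} ∂(M ε S) ∂P) atTop
        (𝓝 (∫ S, h S * ∫ x, φ x * g {i | Xor (Q i ∈ S) (S.IsPivotalAt x (Q i))} ∂(M ε S) ∂P)) := by
    refine tendsto_integral_of_dominated_convergence
      (fun S => ‖∫ x, φ x * g {i | Xor (Q i ∈ S) (S.IsPivotalAt x (Q i))} ∂(M ε S)‖)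
      (fun i => ((hc_meas _).aestronglyMeasurable.mul hRi.aestronglyMeasurable)) hRi.norm
      (fun i => Eventually.of_forall fun S => ?_) ?_
    · rw [norm_mul]
      exact mul_le_of_le_one_left (norm_nonneg _) (hc_norm _ S)
    · filter_upwards [hae] with S hS
      exact hS.mul tendsto_const_nhds
  have heq : (fun i => ∫ S, G (ns i) {j | Qf (ns i) j ∈ S} *
      ∫ x, φ x * g {i | Q i ∈ S} ∂(M ε S) ∂P) =ᶠ[atTop]
        fun i => ∫ S, G (ns i) {j | Qf (ns i) j ∈ S} *
          ∫ x, φ x * g {i | Xor (Q i ∈ S) (S.IsPivotalAt x (Q i))} ∂(M ε S) ∂P := by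
    filter_upwards [eventually_ge_atTop r₀] with i hi
    exact hbal (ns i) (hi.trans (hns.id_le i))
  exact tendsto_nhds_unique (hlimL.congr' heq) hlimR

/-- **Registered form** (sub-goal `flipExtremal_ae_eq_const_of_farCylinderApprox` of item
stmt-CriticalPhenomena-14826): under (ADM), (F) at every cutoff and (EXT), a measurable
`[0,1]`-valued density that is far-cylinder approximable in `L¹(P)` is a.s. equal to its mean.
[folklore] -/
theorem flipExtremal_ae_eq_const_of_farCylinderApprox : ∀ (D : Set ℂ) (P : Measure (QuadConfig D)) (M : ℝ → QuadConfig D → Measure ℂ), IsProbabilityMeasure P → IsAdmissibleKernel P M → (∀ ε : ℝ, 0 < ε → IsFlipFairKernel P (M ε)) → IsFlipExtremal P M → ∀ (h : QuadConfig D → ℝ), Measurable h → (∀ S, 0 ≤ h S ∧ h S ≤ 1) → (∀ (r : ℕ) (δ : ℝ), 0 < δ → ∃ (m : ℕ) (Qf : Fin m → Quad D) (G : Set (Fin m) → ℝ), (∀ A, 0 ≤ G A ∧ G A ≤ 1) ∧ (∀ j, Disjoint (Qf j).carrier (Metric.closedBall (0 : ℂ) r)) ∧ ∫ S, |h S - G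 {j | Qf j ∈ S}| ∂P ≤ δ) → h =ᵐ[P] fun _ => ∫ S, h S ∂P := by
  intro D P M hP hADM hF hEXT h hhm hh happrox
  exact ae_eq_const_of_farCylinderApprox hADM hF hEXT hhm hh happrox

end Summit.CriticalPhenomena.CardyFormulaZ2.Theorems.CardyMeckeFlip

end
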